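import Summits.ValiantsHypothesis.ValiantsHypothesis.Theses.SOSTau
import Literature.Computability.AlgebraicComplexity.ValiantCriterion
import Literature.Computability.AlgebraicComplexity.BurgisserBooleanPartsModPCircuits
import Literature.Computability.AlgebraicComplexity.ValiantClasses
import Literature.Computability.AlgebraicComplexity.TavenasHutchinsonFamily

/-!
# Sketch — crux idea `theta-split-criterion` for `SOSTau.HutchinsonMagnification` (stmt-ValiantsHypothesis-18749)

Ideator planner-cruxidea-stmt-ValiantsHypothesis-18749-1-0 (round 1, k = 1).

THE LEVER (theta split).  The Kurtz/Hutchinson coefficient of `V_n = tavenasV n` is `2^{vExp n i} = 4^{i(D-i)}`,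
`D = 2^n - 1`.  Split the exponent as `i(D - i) = D·i - i²`:
* `4^{D i} = Π_j 4^{D d_j 16^j}` is DIGIT-SEPARABLE (a diagonal scaling of the one-hot lift variables / of `x`),
* `4^{-i²} = q^{i²}` at `q = 1/4` is LEVEL-FREE: `V_n(x) = Θ_{2^n}(4^D x; 1/4)` with the truncated Jacobi theta
  series `Θ_N(u; q) = Σ_{i<N} q^{i²} u^i`.
Hence the hex digit lift of `V_{4m}` is the `q = 1/4` specialisation, diagonally rescaled, of the lift of the
0/1 polynomial `Σ_i u^i z^{bin(i²)}` whose support predicate "the `z`-pattern is the binary expansion of `i²`" is ONE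
squaring gadget — so VNP-membership is VALIANT'S CRITERION verbatim (tree `isVNPFamily_circuitSum`, any commutative
ring, constant-free) followed by a projection of the `z`-variables to the constants `q^{2^t}` (tree
`exists_boolSum_proj_circuitSum`), exactly the V-half architecture already LANDED for the Fekete twin
(`FeketeSOSSOSMagnificationStubVnpAssembly.level_witness`), with Euler's criterion replaced by `HasBits.mul`.

Contents: L0/L0' the split (PROVED); L1 the bits-to-constants scalar identity behind the circuit-sum identity (PROVED);
L2 the predicate-circuit statement (first stub of the future line, `CktSize` form; statement only); L4 the conclusion
(= registered stub V2's conclusion WITHOUT its hypothesis V1; statement only); the TRANSFER `ThetaMagnification`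
(q-uniform, D-free) and the glue `ThetaMagnification → HutchinsonMagnification` (PROVED, scaling `x ↦ 4^D x`).
-/

set_option linter.dupNamespace false

noncomputable section

open MvPolynomial Finset
open Literature.Computability.AlgebraicComplexity
open Literature.Computability.Complexity (CktSize B2)

namespace Summit.ValiantsHypothesis.ValiantsHypothesis.Cruxes.HutchinsonMagnification.ThetaSplit

/-! ### L0 — the theta split of the Kurtz exponent (PROVED) -/

/-- `vExp n i + 2 i² = 2 D i` for `i < 2^n`, `D = 2^n − 1` (no truncated subtraction survives). -/
theorem vExp_add_two_mul_sq (n i : ℕ) (hi : i < 2 ^ n) :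
    vExp n i + 2 * (i * i) = 2 * ((2 ^ n - 1) * i) := by
  unfold vExp
  have h1 : i ≤ 2 ^ n - 1 := by omega
  have key : i * (2 ^ n - 1 - i) + i * i = (2 ^ n - 1) * i := by
    rw [← Nat.mul_add, Nat.sub_add_cancel h1, Nat.mul_comm]
  calc 2 * (i * (2 ^ n - 1 - i)) + 2 * (i * i) = 2 * (i * (2 ^ n - 1 - i) + i * i) := by ring
    _ = 2 * ((2 ^ n - 1) * i) := by rw [key]

/-- L0' — the split over a field: `2^{vExp n i} = 4^{D i} · (4^{i²})⁻¹`. -/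
theorem two_pow_vExp_eq {K : Type*} [Field K] (h2 : (2 : K) ≠ 0) (n i : ℕ) (hi : i < 2 ^ n) :
    ((2 : K) ^ vExp n i) = (4 : K) ^ ((2 ^ n - 1) * i) * ((4 : K) ^ (i * i))⁻¹ := by
  have h := vExp_add_two_mul_sq n i hi
  have h4 : (4 : K) = 2 ^ 2 := by norm_num
  have hne : ((4 : K) ^ (i * i)) ≠ 0 := pow_ne_zero _ (by rw [h4]; exact pow_ne_zero _ h2)
  rw [eq_mul_inv_iff_mul_eq₀ hne, h4, ← pow_mul, ← pow_mul, ← pow_add, h]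

/-! ### L1 — bits select constants: the scalar core of the circuit-sum identity (PROVED)

In the projected Valiant witness, the pattern variables carrying the bits of `i` are sent to the constants
`4^{D 2^u}` and those carrying the bits of `i²` to `(4^{2^t})⁻¹`; at a valid pattern the selected constants multiply to
the Kurtz coefficient.  (`Nat.bitIndices` = the positions of the 1-bits.) -/

theorem prod_bits_scaling_eq {K : Type*} [Field K] (h2 : (2 : K) ≠ 0) (n i : ℕ) (hi : i < 2 ^ n) :
    (∏ u ∈ i.bitIndices.toFinset, (4 : K) ^ ((2 ^ n - 1) * 2 ^ u)) *
      (∏ t ∈ (i * i).bitIndices.toFinset, ((4 : K) ^ (2 ^ t))⁻¹) = (2 : K) ^ vExp n i := by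
  rw [two_pow_vExp_eq h2 n i hi]
  congr 1
  · rw [Finset.prod_pow_eq_pow_sum, ← Finset.mul_sum, Finset.sum_toFinset_bitIndices_two_pow]
  · rw [Finset.prod_inv_distrib, Finset.prod_pow_eq_pow_sum, Finset.sum_toFinset_bitIndices_two_pow]

/-! ### L2 — the predicate circuit (statement; first stub of the future line)

Inputs: the one-hot hex code `y : Fin m × Fin 16 → Bool` of a digit vector `d`, a block `b' : Fin (4m)` and a block
`b'' : Fin (8m)`.  Accept iff `y` is one-hot (some `d`), `b'` = the binary expansion of `i(d) = Σ_j d_j 16^j` (LOCAL: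
bit `4j+r` of `i` is bit `r` of `d_j`) and `b''` = the binary expansion of `i(d)²` (ONE squaring: landed
`HasBits.mul` at modulus `2^{8m}`, exact since `i² < 2^{8m}`; comparison by `CktSizeVia.map₂` + an AND-tree).
Shape copied from the landed `level_witness` hypotheses (hC2: validity + soundness on the code). -/
def Stmt.thetaPredicateCircuit : Prop :=
  ∃ c : ℕ, ∀ m : ℕ, 1 ≤ m →
    ∃ F : ((Fin m × Fin 16) ⊕ (Fin (4 * m) ⊕ Fin (8 * m)) → Bool) → Unit → Bool,
      CktSize B2 F (c * (m + 1) ^ c) ∧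
      (∀ x, F x () = true → ∃ d : Fin m → Fin 16, ∀ v, x (Sum.inl v) = decide (d v.1 = v.2)) ∧
      ∀ (d : Fin m → Fin 16) (b : Fin (4 * m) ⊕ Fin (8 * m) → Bool),
        F (Sum.elim (fun v => decide (d v.1 = v.2)) b) () =
          decide ((∀ u, b (Sum.inl u) = testBits (4 * m) (∑ j : Fin m, (d j : ℕ) * 16 ^ (j : ℕ)) u) ∧
            (∀ t, b (Sum.inr t) = testBits (8 * m) ((∑ j : Fin m, (d j : ℕ) * 16 ^ (j : ℕ)) ^ 2) t))

/-! ### L4 — the conclusion: registered stub V2's conclusion, WITHOUT its hypothesis V1 (statement) -/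
def Stmt.vnpHexLiftDirect : Prop :=
  @IsVNPFamily ℂ _ (fun m => Fin m × Fin 16) _
    (fun m => ∑ i ∈ Finset.range (16 ^ m), C ((2 : ℂ) ^ vExp (4 * m) i) *
      ∏ j : Fin m, X (j, (⟨i / 16 ^ (j : ℕ) % 16, Nat.mod_lt _ (by norm_num)⟩ : Fin 16)))

/-! ### TRANSFER `C⁺ = ThetaMagnification` (q-uniform, D-free) and the glue `C⁺ → crux` (PROVED)

`C⁺`: for every real nome `q`, linear real sparse-SOS hardness of the truncated theta polynomials
`Θ_{16^m}(x; q) = Σ_{i<16^m} q^{i²} x^i` (for all large `m`) implies `VP_ℂ ≠ VNP_ℂ`.  It is STRONGER than the crux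
(its antecedent at `q = 1/4` is implied by the crux's antecedent through the scaling `x ↦ 4^{16^m − 1} x`, proved
below) and its proof is the same collapse with NO level-dependent constant anywhere (witness constants `q^{2^t}` only,
no `vExp`, no `2^n − 1 − i`). -/
def ThetaMagnification : Prop :=
  ∀ q : ℝ, (∃ η : ℝ, 0 < η ∧ ∃ m₀ : ℕ, ∀ m : ℕ, m₀ ≤ m →
      ∀ (s : ℕ) (a : Fin s → ℝ) (g : Fin s → Polynomial ℝ),
        (∑ i, Polynomial.C (a i) * g i ^ 2) =
            ∑ i ∈ Finset.range (16 ^ m), Polynomial.C (q ^ (i * i)) * Polynomial.X ^ i →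
          η * 16 ^ m ≤ ∑ i, ((g i).support.card : ℝ)) → ValiantsHypothesis

/-- Scaling does not change supports: `supp p(cX) = supp p` for `c ≠ 0`. -/
theorem support_comp_C_mul_X (p : Polynomial ℝ) {c : ℝ} (hc : c ≠ 0) :
    (p.comp (Polynomial.C c * Polynomial.X)).support = p.support := by
  ext n
  simp [Polynomial.mem_support_iff, Polynomial.comp_C_mul_X_coeff, hc]

/-- `V_{4m}` is the rescaled truncated theta polynomial at `q = 1/4`:
`V_{4m}(x) = Θ_{16^m}(4^{16^m−1} x; 1/4)` over `ℝ`. -/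
theorem map_tavenasV_eq_theta_comp (m : ℕ) :
    (tavenasV (4 * m)).map (Int.castRingHom ℝ) =
      (∑ i ∈ Finset.range (16 ^ m), Polynomial.C ((1 / 4 : ℝ) ^ (i * i)) * Polynomial.X ^ i).comp
        (Polynomial.C ((4 : ℝ) ^ (16 ^ m - 1)) * Polynomial.X) := by
  have h16 : (2 : ℕ) ^ (4 * m) = 16 ^ m := by rw [pow_mul]; norm_num
  rw [map_tavenasV, h16, Polynomial.sum_comp]
  refine Finset.sum_congr rfl fun i hi => ?_
  rw [Finset.mem_range] at hi
  rw [Polynomial.mul_comp, Polynomial.C_comp, Polynomial.X_pow_comp, mul_pow,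
    ← Polynomial.C_pow, ← mul_assoc, ← Polynomial.C_mul]
  congr 2
  have hi' : i < 2 ^ (4 * m) := by rw [h16]; exact hi
  rw [two_pow_vExp_eq (K := ℝ) two_ne_zero (4 * m) i hi', h16, one_div, inv_pow, ← pow_mul, mul_comm]

/-- **The glue (PROVED): `ThetaMagnification → HutchinsonMagnification`.**  From linear real SOS-hardness of
`V_n` (all large `n`) get the same hardness for `Θ_{16^m}(·; 1/4)` by rescaling any representation, then apply `C⁺`
at `q = 1/4`. -/
theorem hutchinsonMagnification_of_theta (hT : ThetaMagnification) :
    Summit.ValiantsHypothesis.ValiantsHypothesis.Theses.SOSTau.HutchinsonMagnification := by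
  rintro ⟨η, hη, n₀, H⟩
  refine hT (1 / 4) ⟨η, hη, n₀, fun m hm s a g hrep => ?_⟩
  set L : ℝ := (4 : ℝ) ^ (16 ^ m - 1) with hL
  have hLne : L ≠ 0 := pow_ne_zero _ (by norm_num)
  have hrep' : (∑ i, Polynomial.C (a i) * ((g i).comp (Polynomial.C L * Polynomial.X)) ^ 2) =
      (tavenasV (4 * m)).map (Int.castRingHom ℝ) := by
    rw [map_tavenasV_eq_theta_comp, ← hrep, Polynomial.sum_comp]
    refine Finset.sum_congr rfl fun i _ => ?_
    rw [Polynomial.mul_comp, Polynomial.pow_comp, Polynomial.C_comp]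
  have key := H (4 * m) (by omega) s a (fun i => (g i).comp (Polynomial.C L * Polynomial.X)) hrep'
  have h16 : (2 : ℝ) ^ (4 * m) = 16 ^ m := by rw [pow_mul]; norm_num
  simp only [support_comp_C_mul_X _ hLne, h16] at key
  exact key


/-! ### L5 — Card `bit-sum-selector-witness`: the Boolean-point weight identity (complement form)

Boolean block = the `4m` BITS `b` of `i` (bijective coding, `Nat.ofBits`), weight
`Π_{u,u'} (2^{2^{u+u'+1}})^{[b_u ∧ ¬ b_{u'}]}`; at a Boolean point it is the Kurtz coefficient because
`Σ_{u'} [¬ b_{u'}] 2^{u'} = (2^w − 1) − i` (all-ones `D`, used exactly here) and `2 i (D − i) = vExp w i`. -/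

/-- The two half-sums of the bits: `i + ī = 2^w − 1`. -/
theorem ofBits_add_ofBits_not (w : ℕ) (b : Fin w → Bool) :
    (∑ u : Fin w, (b u).toNat * 2 ^ (u : ℕ)) + (∑ u : Fin w, (!b u).toNat * 2 ^ (u : ℕ)) = 2 ^ w - 1 := by
  rw [← Finset.sum_add_distrib]
  have h : ∀ u : Fin w, (b u).toNat * 2 ^ (u : ℕ) + (!b u).toNat * 2 ^ (u : ℕ) = 2 ^ (u : ℕ) := by
    intro u; cases b u <;> simp
  simp_rw [h]
  rw [Fin.sum_univ_eq_sum_range (fun u => 2 ^ u) w, Nat.geomSum_eq le_rfl w]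
  simp

/-- **L5 (PROVED).** `Π_{u,u'} (2^{2^{u+u'+1}})^{[b_u ∧ ¬b_{u'}]} = 2^{vExp w (ofBits b)}`. -/
theorem prod_bitPairs_eq_two_pow_vExp (w : ℕ) (b : Fin w → Bool) :
    (∏ u : Fin w, ∏ u' : Fin w,
        (if (b u && !b u') = true then (2 : ℂ) ^ 2 ^ ((u : ℕ) + (u' : ℕ) + 1) else 1)) =
      (2 : ℂ) ^ vExp w (Nat.ofBits b) := by
  -- each factor is `2 ^ (if … then 2^{u+u'+1} else 0)`
  have hf : ∀ u u' : Fin w, (if (b u && !b u') = true then (2 : ℂ) ^ 2 ^ ((u : ℕ) + (u' : ℕ) + 1) else 1) =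
      (2 : ℂ) ^ ((b u).toNat * (!b u').toNat * 2 ^ ((u : ℕ) + (u' : ℕ) + 1)) := by
    intro u u'; cases b u <;> cases b u' <;> simp
  simp_rw [hf, Finset.prod_pow_eq_pow_sum]
  congr 1
  -- the exponent: `Σ_{u,u'} b_u (1 - b_{u'}) 2^{u+u'+1} = 2 · i · (D − i)`
  have hD := ofBits_add_ofBits_not w b
  unfold vExp
  rw [BoolGadgets.ofBits_eq_sum]
  set i := ∑ u : Fin w, (b u).toNat * 2 ^ (u : ℕ) with hi
  set i' := ∑ u : Fin w, (!b u).toNat * 2 ^ (u : ℕ) with hi'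
  have hsub : 2 ^ w - 1 - i = i' := by omega
  rw [hsub, hi, hi', Finset.sum_mul_sum, Finset.mul_sum]
  refine Finset.sum_congr rfl fun u _ => ?_
  rw [Finset.mul_sum]
  refine Finset.sum_congr rfl fun u' _ => ?_
  rw [pow_add, pow_add, pow_one]
  ring


/-! ### L6 — Card `bit-sum-selector-witness`: the explicit Def-2.5 witness over the BITS (statement)

Boolean block `Fin (4m)` (bits `B_u = X (inr u)` of `i`), lift variables `X (inl (j,h))`.  Witness
`G_m = [Π_{u,u'} (1 + (2^{2^{u+u'+1}} − 1) B_u (1 − B_{u'}))] · Π_j mux16 (B_{4j}, …, B_{4j+3}) (X_{(j,0)}, …, X_{(j,15)})`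
where `mux16 β y = Σ_{h<16} (Π_{r<4} (β_r if bit r of h else 1 − β_r)) · y_h` is the 16-way multiplexer (evaluates to
`y_{ofBits β}` at a Boolean `β`).  Every `b ∈ {0,1}^{4m}` is a valid code (`Nat.ofBits` bijects onto `[0,16^m)`; landed
`BoolGadgets.sum_boolVec_eq_sum_range`, `ofBits_injective`), so NO validity gadget and NO `circuitSum_reindex`. -/

/-- The 16-way multiplexer polynomial driven by four bit polynomials. -/
def mux16 {τ : Type*} (β : Fin 4 → MvPolynomial τ ℂ) (y : Fin 16 → MvPolynomial τ ℂ) : MvPolynomial τ ℂ :=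
  ∑ h : Fin 16, (∏ r : Fin 4, if Nat.testBit (h : ℕ) (r : ℕ) then β r else 1 - β r) * y h

/-- The bit-sum witness `G_m` = `gWitness m` (complement-bilinear weight × multiplexers). -/
def gWitness (m : ℕ) : MvPolynomial ((Fin m × Fin 16) ⊕ Fin (4 * m)) ℂ :=
  (∏ u : Fin (4 * m), ∏ u' : Fin (4 * m),
      (1 + (C ((2 : ℂ) ^ 2 ^ ((u : ℕ) + (u' : ℕ) + 1)) - 1) * X (Sum.inr u) * (1 - X (Sum.inr u')))) *
    ∏ j : Fin m, mux16 (fun r : Fin 4 => X (Sum.inr ⟨4 * (j : ℕ) + (r : ℕ), by omega⟩))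
      (fun h : Fin 16 => X (Sum.inl (j, h)))

/-- **L6 (statement; the M-sized core of the card's V-half).**  The Boolean sum of `G_m` over the `4m` bits is the hex
digit lift `P_m` of `V_{4m}`, and `G_m` has complexity and degree `O(m²)` — hence (`isVNPFamily_of_levelwise'`) the
conclusion `Stmt.vnpHexLiftDirect`.  At a Boolean point `b` the weight factor is `2^{vExp (4m) (ofBits b)}` (L5, PROVED)
and the multiplexers give `Π_j X_{(j, digit_j)}`. -/
def Stmt.bitSumWitness : Prop :=
  ∃ c : ℕ, ∀ m : ℕ,
    boolSum (gWitness m) =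
        ∑ i ∈ Finset.range (16 ^ m), C ((2 : ℂ) ^ vExp (4 * m) i) *
          ∏ j : Fin m, X (j, (⟨i / 16 ^ (j : ℕ) % 16, Nat.mod_lt _ (by norm_num)⟩ : Fin 16)) ∧
      complexity (gWitness m) ≤ c * (m + 1) ^ 2 ∧ (gWitness m).totalDegree ≤ c * (m + 1) ^ 2

end Summit.ValiantsHypothesis.ValiantsHypothesis.Cruxes.HutchinsonMagnification.ThetaSplit

end
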